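import Summits.MatrixMultiplication.MatrixMultiplication.Theses.WindowedCompletionRank
import Summits.MatrixMultiplication.MatrixMultiplication.Theorems.WindowedCompletionRankWeylPresentation
import Summits.MatrixMultiplication.MatrixMultiplication.Theorems.WindowedCompletionRankThesisStubKroneckerLadder
import Literature.Computability.AlgebraicComplexity.FlatteningBound

/-!
# `WindowedCompletionRank.Thesis` (crux stmt-MatrixMultiplication-5491): what a Weyl seed buys — a level `ε < 1` at all scales

Support file of line `registered` (seed + Kronecker ladder + amplification), lead
prover-line-stmt-MatrixMultiplication-5491-c1-0; `sorry`-free.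

Write `Body n ε` for the matrix of the crux (`G, α, β, γ, S` with `|G| ≤ n^(2+ε)`, `R(S) ≤ n^ε`,
`⟨n,n,n⟩ ≤ [α b + β c = γ a]·S(γ a, α b, β c)`), so that `Thesis` is `∀ ε > 0, ∃ n ≥ 2, Body n ε`
(spelled out verbatim below; no auxiliary definition). The refuter's calibration
(`Theorems/Thesis/Negative/WindowedCompletionRankNoSingleLevel.lean`) shows: the level `ε = 0` is
attained at no `n`, every level `ε ≥ 1` is attained at every `n ≥ 2` (TPP frame), and `Thesis` says
the infimum of attained levels is `0`.

Here: the SEED stub of the line (`WeylBeatsTrivial`, item stmt-MatrixMultiplication-5494: a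
completion `S` of the clock-and-shift cocycle on `((ℤ_m^k)²)³` with `c := R(S) < m^k`) pushes the
attained levels strictly below `1`, at ALL scales: with `ε₀ := log_{m^k} c ∈ [0, 1)`, the level `ε₀`
is attained at `n = m^{jk}` for every `j ≥ 1` (`thesis_level_of_weylBeatsTrivial`), in particular at
arbitrarily large `n` (`thesis_level_lt_one_io_of_weylBeatsTrivial`). Ingredients: the landed
Kronecker ladder `stub_kroneckerLadder` (completions of rank `≤ c^j = (m^{jk})^{ε₀}` at level `jk`),
the landed clock-and-shift presentation `weylPresentation_proof` (stmt-5498), and `|G| = n²`.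
What the seed does NOT buy is any level below `ε₀`: that is the amplification stub `stub_amplify`
(ω = 2-strength), equivalently crux `WeylCompletion` (stmt-5492) given the seed.
-/

-- single-problem summit: `Summit.MatrixMultiplication.MatrixMultiplication.…` is the mandated namespace
set_option linter.dupNamespace false

namespace Summit.MatrixMultiplication.MatrixMultiplication.Theorems.Thesis

open Literature.Computability.AlgebraicComplexity
open Summit.MatrixMultiplication.MatrixMultiplication.Theses.WindowedCompletionRank
open Summit.MatrixMultiplication.MatrixMultiplication.Theorems

/-- A completion of the clock-and-shift cocycle is not the zero tensor, so its rank is `≥ 1`. -/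
theorem one_le_tensorRank_of_cocycle {m k : ℕ} [NeZero m]
    (S : ((Fin k → ZMod m) × (Fin k → ZMod m)) → ((Fin k → ZMod m) × (Fin k → ZMod m)) →
      ((Fin k → ZMod m) × (Fin k → ZMod m)) → ℂ)
    (hS : ∀ g h : (Fin k → ZMod m) × (Fin k → ZMod m),
      S (g + h) g h = Complex.exp (2 * Real.pi * Complex.I * ((∑ i, g.2 i * h.1 i).val : ℂ) / m)) :
    1 ≤ tensorRank S := by
  by_contra h0
  have h0' : tensorRank S = 0 := by omega
  obtain ⟨w, u, v, hdec⟩ := exists_triad_decomposition_tensorRank S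
  have hIs : IsEmpty (Fin (tensorRank S)) := by
    rw [h0']
    infer_instance
  have hzero : S (0 + 0) 0 0 = 0 := by
    rw [hdec, sum_triad_apply]
    exact Finset.sum_of_isEmpty _
  rw [hS 0 0] at hzero
  exact Complex.exp_ne_zero _ hzero

/-- **A Weyl seed attains a level `ε₀ < 1` of the crux body at every scale `n = m^{jk}`.**
From `WeylBeatsTrivial` (seed `(m, k, S)`, `c := R(S) < m^k`): with `ε₀ := log_{m^k} c ∈ [0,1)`,
for every `j ≥ 1` the body of `Thesis` holds at `n = m^{jk}` and `ε = ε₀` — `G = (ℤ_m^{jk})²`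
(`|G| = n²`), `α = β = γ` a counting bijection, `S_j` the `j`-th rung of the Kronecker ladder
(`R(S_j) ≤ c^j = n^{ε₀}`), restriction by the clock-and-shift presentation. -/
theorem thesis_level_of_weylBeatsTrivial (hW : WeylBeatsTrivial) :
    ∃ (m k : ℕ) (ε : ℝ), 2 ≤ m ∧ 1 ≤ k ∧ 0 ≤ ε ∧ ε < 1 ∧ ∀ j : ℕ, 1 ≤ j →
      ∃ (G : Type) (_ : AddCommGroup G) (_ : Fintype G) (_ : DecidableEq G),
        (Fintype.card G : ℝ) ≤ ((m ^ (j * k) : ℕ) : ℝ) ^ (2 + ε) ∧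
        ∃ (α β γ : Fin (m ^ (j * k)) × Fin (m ^ (j * k)) → G) (S : G → G → G → ℂ),
          (tensorRank S : ℝ) ≤ ((m ^ (j * k) : ℕ) : ℝ) ^ ε ∧
          TensorRestrictsTo
            (fun a b c : Fin (m ^ (j * k)) × Fin (m ^ (j * k)) =>
              if α b + β c = γ a then S (γ a) (α b) (β c) else 0)
            (matMulTensor ℂ (m ^ (j * k)) (m ^ (j * k)) (m ^ (j * k))) := by
  obtain ⟨m, hm, k, hk, S, hS, hlt⟩ := hW
  haveI : NeZero m := ⟨by omega⟩
  have hc1 : 1 ≤ tensorRank S := one_le_tensorRank_of_cocycle S hS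
  set c : ℕ := tensorRank S with hc
  -- the base `b = m^k > 1` and the level `ε₀ = log_b c`
  have hb2 : 2 ≤ m ^ k := by
    calc 2 ≤ m := hm
      _ = m ^ 1 := (pow_one m).symm
      _ ≤ m ^ k := Nat.pow_le_pow_right (by omega) hk
  have hbR1 : (1 : ℝ) < ((m ^ k : ℕ) : ℝ) := by exact_mod_cast (lt_of_lt_of_le (by norm_num) hb2)
  have hbR0 : (0 : ℝ) < ((m ^ k : ℕ) : ℝ) := by linarith
  have hcR0 : (0 : ℝ) < (c : ℝ) := by exact_mod_cast hc1
  set ε : ℝ := Real.logb ((m ^ k : ℕ) : ℝ) c with hε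
  have hε0 : 0 ≤ ε := Real.logb_nonneg hbR1 (by exact_mod_cast hc1)
  have hε1 : ε < 1 := by
    rw [hε, ← Real.logb_self_eq_one hbR1]
    exact Real.logb_lt_logb hbR1 hcR0 (by exact_mod_cast hlt)
  have hcpow : ((m ^ k : ℕ) : ℝ) ^ ε = c := by
    rw [hε, Real.rpow_logb hbR0 hbR1.ne' hcR0]
  refine ⟨m, k, ε, hm, hk, hε0, hε1, fun j hj => ?_⟩
  -- the j-th rung of the Kronecker ladder
  obtain ⟨Sj, hSj, hrankj⟩ := stub_kroneckerLadder m k c hm ⟨S, hS, le_rfl⟩ j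
  have h1m : 1 ≤ m := by omega
  -- the group `G = (ℤ_m^{jk})²` and a counting bijection `[m^{jk}]² ≃ G`
  have hcardG : Fintype.card ((Fin (j * k) → ZMod m) × (Fin (j * k) → ZMod m)) =
      m ^ (j * k) * m ^ (j * k) := by
    simp [Fintype.card_prod, Fintype.card_pi, ZMod.card, Finset.prod_const]
  have hcardF : Fintype.card (Fin (m ^ (j * k)) × Fin (m ^ (j * k))) = m ^ (j * k) * m ^ (j * k) := by
    simp [Fintype.card_prod]
  let e : Fin (m ^ (j * k)) × Fin (m ^ (j * k)) ≃ (Fin (j * k) → ZMod m) × (Fin (j * k) → ZMod m) :=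
    Fintype.equivOfCardEq (hcardF.trans hcardG.symm)
  -- real bookkeeping on `n = m^{jk} = (m^k)^j`
  have hn_eq : ((m ^ (j * k) : ℕ) : ℝ) = ((m ^ k : ℕ) : ℝ) ^ (j : ℝ) := by
    rw [Real.rpow_natCast]
    push_cast
    rw [← pow_mul, mul_comm k j]
  have hN1 : (1 : ℝ) ≤ ((m ^ (j * k) : ℕ) : ℝ) := by
    rw [hn_eq]
    exact Real.one_le_rpow hbR1.le (Nat.cast_nonneg j)
  have hN0 : (0 : ℝ) < ((m ^ (j * k) : ℕ) : ℝ) := by linarith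
  refine ⟨(Fin (j * k) → ZMod m) × (Fin (j * k) → ZMod m), inferInstance, inferInstance, inferInstance,
    ?_, e, e, e, Sj, ?_, weylPresentation_proof m (j * k) h1m Sj hSj e⟩
  · -- `|G| = n² ≤ n^(2+ε)` since `ε ≥ 0`
    rw [hcardG, Real.rpow_add hN0, Real.rpow_two]
    have hε1' : (1 : ℝ) ≤ ((m ^ (j * k) : ℕ) : ℝ) ^ ε := Real.one_le_rpow hN1 hε0
    have hsq : (((m ^ (j * k) * m ^ (j * k) : ℕ) : ℝ)) = ((m ^ (j * k) : ℕ) : ℝ) ^ 2 := by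
      push_cast
      ring
    rw [hsq]
    nlinarith [sq_nonneg (((m ^ (j * k) : ℕ) : ℝ))]
  · -- `R(S_j) ≤ c^j = ((m^k)^ε)^j = (m^{jk})^ε`
    calc (tensorRank Sj : ℝ) ≤ ((c ^ j : ℕ) : ℝ) := by exact_mod_cast hrankj
      _ = (((m ^ k : ℕ) : ℝ) ^ ε) ^ (j : ℝ) := by
          rw [hcpow, Real.rpow_natCast]
          push_cast
          rfl
      _ = ((m ^ (j * k) : ℕ) : ℝ) ^ ε := by
          rw [← Real.rpow_mul hbR0.le, mul_comm ε (j : ℝ), Real.rpow_mul hbR0.le, ← hn_eq]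

/-- **Consequently a Weyl seed attains some level `ε < 1` of the crux at arbitrarily large `n`**
(the crux asks for levels arbitrarily close to `0`). The body is that of `Thesis`, verbatim. -/
theorem thesis_level_lt_one_io_of_weylBeatsTrivial (hW : WeylBeatsTrivial) :
    ∃ ε : ℝ, 0 ≤ ε ∧ ε < 1 ∧ ∀ N : ℕ, ∃ n : ℕ, N ≤ n ∧ 2 ≤ n ∧
      ∃ (G : Type) (_ : AddCommGroup G) (_ : Fintype G) (_ : DecidableEq G),
        (Fintype.card G : ℝ) ≤ (n : ℝ) ^ (2 + ε) ∧
        ∃ (α β γ : Fin n × Fin n → G) (S : G → G → G → ℂ),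
          (tensorRank S : ℝ) ≤ (n : ℝ) ^ ε ∧
          TensorRestrictsTo
            (fun a b c : Fin n × Fin n => if α b + β c = γ a then S (γ a) (α b) (β c) else 0)
            (matMulTensor ℂ n n n) := by
  obtain ⟨m, k, ε, hm, hk, hε0, hε1, hlev⟩ := thesis_level_of_weylBeatsTrivial hW
  refine ⟨ε, hε0, hε1, fun N => ⟨m ^ ((N + 1) * k), ?_, ?_, hlev (N + 1) (Nat.succ_le_succ (Nat.zero_le N))⟩⟩
  · -- `N ≤ N + 1 ≤ 2^(N+1) ≤ m^(N+1) ≤ m^((N+1)k)`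
    calc N ≤ N + 1 := Nat.le_succ N
      _ ≤ 2 ^ (N + 1) := (Nat.lt_two_pow_self).le
      _ ≤ m ^ (N + 1) := Nat.pow_le_pow_left hm (N + 1)
      _ ≤ m ^ ((N + 1) * k) := Nat.pow_le_pow_right (by omega) (Nat.le_mul_of_pos_right _ hk)
  · calc 2 ≤ m := hm
      _ = m ^ 1 := (pow_one m).symm
      _ ≤ m ^ ((N + 1) * k) := Nat.pow_le_pow_right (by omega) (Nat.mul_pos (Nat.succ_pos N) hk)

end Summit.MatrixMultiplication.MatrixMultiplication.Theorems.Thesis
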